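import Summits.CriticalPhenomena.PercolationContinuityZ3.Theorems.PercNearOneGluingNoHeavyLowerTailSahiLatinZeroDescent
import Summits.CriticalPhenomena.PercolationContinuityZ3.Theorems.PercNearOneGluingNoHeavyLowerTailSahiLatinRelabel
import Summits.CriticalPhenomena.PercolationContinuityZ3.Theorems.PercNearOneGluingNoHeavyLowerTailSahiLatinDictionary

/-!
# `NoHeavyLowerTail` (crux stmt-CriticalPhenomena-4575), Sahi programme (prim-master-conj gen 43): ZEROS of the Latin kernel, IV — the UNCONDITIONAL
# zero descent and rigidity on `[3]^d`, `d ≤ 4`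

Support file (`--supports stmt-CriticalPhenomena-4575`; COMPUTATIONAL through `…SahiLatinDictionary` → `…SahiPatternPosFour` (FBP(3,4) =
`SahiGridPattern.patternPos_four`, prim-sahi-typer gens 31–32, twenty `native_decide` chunks); sequel of `…SahiLatinZeros/Indep/ZeroDescent`).

FBP(3,d) = `LatinPos (Fin d)` is a tree theorem for `d ≤ 4` (`SahiLatin.latinPos_of_le_four`), so on `[3]^d`, `d ≤ 4`, the conditional results of the
previous files hold outright:
* **`exists_terminal_zero_reach_of_le_four`** — every triple of up-sets of `[3]^d` (`d ≤ 4`) with `κ = 0` (equivalently `sStarD = 0`,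
  `SahiLatin.kappa_eq_sStarD`) reaches, by cost-free R- and A-moves through zeros only, a TERMINAL zero;
* `Reach.kappa_eq_zero_of_le_four` — everything reachable from a zero is a zero;
* the rigidity of zeros (`link_subset_of_isMinOf_of_zero_of_le_four`, `inessential_or_of_isMaxOut_of_zero_of_le_four`,
  `kappa_union_inter_eq_zero_of_zero_of_le_four`);
* **`exists_indep_reach_of_zero_of_le_four`** — under conjecture TZ alone (`TerminalZerosIndep (Fin d)`): `κ = 0` iff the triple reaches a pairwise
  independent terminal triple through zeros (`d = 3`: the structure of all 16 932 ordered zeros with proper members, memo §2).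
Nothing here asserts TZ or FBP for `d ≥ 5`. [this work]
-/

namespace Summit.CriticalPhenomena.PercolationContinuityZ3.Theorems.SahiLatin

open Finset

variable {d : ℕ}

/-- **UNCONDITIONAL ZERO DESCENT on `[3]^d`, `d ≤ 4`**: every zero of the Latin kernel reaches a terminal zero through zeros. [this work] -/
theorem exists_terminal_zero_reach_of_le_four (hd : d ≤ 4) {a b c : Finset (Pt (Fin d))} (hup : UpTriple a b c) (h0 : kappa a b c = 0) :
    ∃ a' b' c' : Finset (Pt (Fin d)), UpTriple a' b' c' ∧ Terminal a' b' c' ∧ Reach (a, b, c) (a', b', c') ∧ kappa a' b' c' = 0 :=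
  exists_terminal_zero_reach (latinPos_of_le_four hd) hup h0

/-- On `[3]^d`, `d ≤ 4`: everything reachable from a zero by R- and A-moves is a zero. [this work] -/
theorem Reach.kappa_eq_zero_of_le_four (hd : d ≤ 4) {s t : Trip (Fin d)} (h : Reach s t) (hs : s.Up) (h0 : s.kappa = 0) :
    t.kappa = 0 :=
  h.kappa_eq_zero (latinPos_of_le_four hd) hs h0

/-- On `[3]^d`, `d ≤ 4`: at a zero, the whole link of a minimal element of `a` lying in `b ∩ c` lies in `b ∩ c`. [this work] -/
theorem link_subset_of_isMinOf_of_zero_of_le_four (hd : d ≤ 4) {a b c : Finset (Pt (Fin d))} (hup : UpTriple a b c)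
    (h0 : kappa a b c = 0) {m : Pt (Fin d)} (hm : IsMinOf a m) (hmb : m ∈ b) (hmc : m ∈ c) : ∀ y ∈ link m, y ∈ b ∧ y ∈ c :=
  link_subset_of_isMinOf_of_zero (latinPos_of_le_four hd) hup h0 hm hmb hmc

/-- On `[3]^d`, `d ≤ 4`: at a zero, a maximal non-element of `a` outside `b ∪ c` has traces of `b, c` on its link with no common essential axis.
[this work] -/
theorem inessential_or_of_isMaxOut_of_zero_of_le_four (hd : d ≤ 4) {a b c : Finset (Pt (Fin d))} (hup : UpTriple a b c)
    (h0 : kappa a b c = 0) {m : Pt (Fin d)} (hm : IsMaxOut a m) (hmb : m ∉ b) (hmc : m ∉ c) (i : Fin d) :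
    FiveUpSet.Inessential i (fam m b) ∨ FiveUpSet.Inessential i (fam m c) :=
  inessential_or_of_isMaxOut_of_zero (latinPos_of_le_four hd) hup h0 hm hmb hmc i

/-- On `[3]^d`, `d ≤ 4`: at a zero, the Lieb–Sahi averages `a ∪ τa`, `a ∩ τa` along an adjacent transposition `τ` fixing `b, c` are zeros. [this work] -/
theorem kappa_union_inter_eq_zero_of_zero_of_le_four (hd : d ≤ 4) {a b c : Finset (Pt (Fin d))} (hup : UpTriple a b c)
    (h0 : kappa a b c = 0) (i : Fin d) {l l' : Fin 3} (hadj : Adjacent l l') (hb : relabel i (Equiv.swap l l') b = b)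
    (hc : relabel i (Equiv.swap l l') c = c) :
    kappa (a ∪ relabel i (Equiv.swap l l') a) b c = 0 ∧ kappa (a ∩ relabel i (Equiv.swap l l') a) b c = 0 :=
  kappa_union_inter_eq_zero_of_zero (latinPos_of_le_four hd) hup h0 i hadj hb hc

/-- **THE ZERO LOCUS on `[3]^d`, `d ≤ 4`, under TZ alone**: every zero reaches a pairwise independent terminal triple through zeros. [this work] -/
theorem exists_indep_reach_of_zero_of_le_four (hd : d ≤ 4) (hTZ : TerminalZerosIndep (Fin d)) {a b c : Finset (Pt (Fin d))}
    (hup : UpTriple a b c) (h0 : kappa a b c = 0) :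
    ∃ a' b' c' : Finset (Pt (Fin d)), UpTriple a' b' c' ∧ Terminal a' b' c' ∧ Reach (a, b, c) (a', b', c') ∧ kappa a' b' c' = 0 ∧
      Indep a' b' ∧ Indep a' c' ∧ Indep b' c' :=
  exists_indep_reach_of_zero (latinPos_of_le_four hd) hTZ hup h0

/-- The same in the Sahi cell's vocabulary: a zero of the pattern functional `sStarD` on `[3]^d`, `d ≤ 4`, descends through zeros to a terminal zero.
[this work] -/
theorem exists_terminal_zero_reach_of_sStarD_eq_zero (hd : d ≤ 4) {a b c : Finset (Pt (Fin d))} (hup : UpTriple a b c)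
    (h0 : SahiGridPattern.sStarD a b c = 0) :
    ∃ a' b' c' : Finset (Pt (Fin d)), UpTriple a' b' c' ∧ Terminal a' b' c' ∧ Reach (a, b, c) (a', b', c') ∧
      SahiGridPattern.sStarD a' b' c' = 0 := by
  rw [← kappa_eq_sStarD] at h0
  obtain ⟨a', b', c', hup', hT, hR, h0'⟩ := exists_terminal_zero_reach_of_le_four hd hup h0
  exact ⟨a', b', c', hup', hT, hR, by rw [← kappa_eq_sStarD]; exact h0'⟩

end Summit.CriticalPhenomena.PercolationContinuityZ3.Theorems.SahiLatin
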